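import Summits.QuantumFields.YangMills.Theorems.ConvexGribovBodyPoincareToGapRetentionToGap
import Summits.QuantumFields.YangMills.Theorems.ConvexGribovBodyPoincareToGapRetentionOfSmoothWitnessArc

/-!
# Clustering from the two-end-slice Poincaré inequality, modulo the arc smooth witness
(crux `ConvexGribovBody.PoincareToGap`, line `Sketch`; lead c3 — the PIN-FREE re-typing interface)

Torus `(ℤ/(2S+1))⁴`, Wilson state `μ = wilsonMeasure r.ρ β`, arc of `ℓ` time slices from `s` (`3 ≤ ℓ`, `ℓ + 3 ≤ 2S+1`),
`E_{s,ℓ}` = the SPATIAL links of its two END slices (time offsets `0` and `ℓ − 1`), `O` = the links outside the arc,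
`P_O := μ[· | cylinderEvents O]`, `dir_{s,ℓ}` = the crux's single-link Dirichlet form summed over `E_{s,ℓ}`.

`gapAt_of_twoSlicePoincare_of_smoothWitnessArc`: for fixed `G, r, β > 0, κ, S₀, C, S₁`, IF
* (HYP₂ — TWO-END-SLICE POINCARÉ) on every torus `S ≥ S₀`, for every arc and every gauge-invariant link-Lipschitz `f`
  reading only `E_{s,ℓ}`: `Var_μ f ≤ κ · dir_{s,ℓ} f`, and
* (SW_arc — ARC SMOOTH WITNESS) on every torus `S ≥ S₁`, for every arc and every bounded measurable gauge-invariant `F`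
  reading only `E_{s,ℓ}` there is an admissible `F₁` (measurable, bounded, gauge-invariant, reading `E_{s,ℓ}`,
  link-Lipschitz) with `dir_{s,ℓ}(F₁)/β + ∫ (F − F₁)² ≤ C ∫ (F − P_O F)²`,
THEN the conclusion of `ConvexGribovBody.PoincareToGap` holds: `∃ m > 0, S₂, ∀ A B : YMSpecies G, ∃ C', ∀ S ≥ S₂, n ≤ S,
|latticeConnectedCorr r.ρ β (2S+1) A.F B.F n| ≤ C' e^{−m n}`.

Proof: `stub_arcRetention_of_smoothWitnessArc` (p157847) gives two-time arc retention
`Var F ≤ K ‖F − P_O F‖²`, `K = max(2 max(κβ,1) C, 1)`, on all tori `S ≥ max S₀ S₁`; this is the hypothesis of the landed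
`stub_gapAt_of_twoTimeRetention` (C2, p122459: kernel versions + cyclic peeling + assembly) with `ε = 1/K ∈ (0, 1]`.

WHY THIS INTERFACE (Cruxes/PoincareToGap/NOTES.md §10): the crux AS TYPED (one-slice hypothesis) closes modulo SW ∧ PB2, and its
hypothesis has no known way to feed PB2 (the far-pinned twin; conditional statements quantified over all bounded test functions
are ess-sup-over-pins statements by a zooming argument).  HYP₂ is the pin-free strengthening of the hypothesis (a Poincaré
inequality for the joint law of two time slices w.r.t. the Dirichlet form over both; it contains the one-slice hypothesis) under
which the two-slice split PB1/PB2 — and with it the knot K-b — disappears: the residue is the single hypothesis-free heart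
SW_arc, the arc analogue of `stub_smoothWitness`.

References: P. Diaconis, L. Saloff-Coste, Ann. Appl. Probab. 3 (1993) 696–730; F. Martinelli, LNM 1717 (1999), §3.
-/

noncomputable section

open scoped BigOperators Topology
open MeasureTheory ProbabilityTheory Filter
open Literature.MathematicalPhysics.QuantumFieldTheory Literature.MathematicalPhysics.QuantumLattice

namespace Summit.QuantumFields.YangMills.Theorems.PoincareToGap

/-- **GapAt from the TWO-END-SLICE Poincaré inequality, modulo the arc smooth witness** (pin-free re-typing of K3):
if (HYP₂) on all tori `S ≥ S₀`, for every arc (`s`, `3 ≤ ℓ`, `ℓ + 3 ≤ 2S+1`), every gauge-invariant link-Lipschitz `f`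
reading the spatial links of the two END slices satisfies `Var f ≤ κ · dir_{s,u} f` (Dirichlet form over those links), and
(SW_arc) with constants `C, S₁` every bounded measurable gauge-invariant such `F` has an admissible witness `F₁` with
`dir_{s,u}(F₁)/β + ‖F − F₁‖² ≤ C ‖F − P_{outside} F‖²`, then all pairs of local gauge-invariant observables cluster
exponentially in time, volume-uniformly (`n ≤ S`).  Proof: L1_arc gives two-time arc retention with
`ε = 1/max(2 max(κβ,1) C, 1)`, and C2 `stub_gapAt_of_twoTimeRetention` (landed) concludes. -/
theorem gapAt_of_twoSlicePoincare_of_smoothWitnessArc :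
    ∀ (G : Type) [Group G] [TopologicalSpace G] [IsTopologicalGroup G] [CompactSpace G]
      [MeasurableSpace G] [BorelSpace G] (r : LatticeRep G) (β : ℝ), 0 < β → ∀ (κ : ℝ) (S₀ : ℕ),
    (∀ S : ℕ, S₀ ≤ S → ∀ (s : ZMod (2 * S + 1)) (ℓ : ℕ), 3 ≤ ℓ → ℓ + 3 ≤ 2 * S + 1 →
      ∀ f : GaugeConfig 4 (2 * S + 1) G → ℝ, IsGaugeInvariant f →
      (∀ U V : GaugeConfig 4 (2 * S + 1) G,
        (∀ e : Edge 4 (2 * S + 1), ((e.1 0 - s).val = 0 ∨ (e.1 0 - s).val = ℓ - 1) → e.2 ≠ 0 → U e = V e) →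
          f U = f V) →
      (∃ K : ℝ, ∀ U V : GaugeConfig 4 (2 * S + 1) G,
        |f U - f V| ≤ K * ∑ e, Real.sqrt (∑ a, ∑ b, ‖(r.ρ (U e) - r.ρ (V e)) a b‖ ^ 2)) →
      ∫ U, (f U - ∫ V, f V ∂(wilsonMeasure r.ρ β : Measure (GaugeConfig 4 (2 * S + 1) G))) ^ 2
          ∂(wilsonMeasure r.ρ β : Measure (GaugeConfig 4 (2 * S + 1) G)) ≤
        κ * ∑ e : Edge 4 (2 * S + 1), (if ((e.1 0 - s).val = 0 ∨ (e.1 0 - s).val = ℓ - 1) ∧ e.2 ≠ 0 then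
          ∫ U, (Filter.limsup (fun g : G => |f (Function.update U e g) - f U| /
              Real.sqrt (∑ a, ∑ b, ‖(r.ρ g - r.ρ (U e)) a b‖ ^ 2)) (𝓝[≠] (U e))) ^ 2
            ∂(wilsonMeasure r.ρ β : Measure (GaugeConfig 4 (2 * S + 1) G)) else 0)) →
    ∀ (C : ℝ) (S₁ : ℕ),
    (∀ S : ℕ, S₁ ≤ S → ∀ μ : Measure (GaugeConfig 4 (2 * S + 1) G),
      μ = (wilsonMeasure r.ρ β : Measure (GaugeConfig 4 (2 * S + 1) G)) →
      ∀ (s : ZMod (2 * S + 1)) (ℓ : ℕ), 3 ≤ ℓ → ℓ + 3 ≤ 2 * S + 1 →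
      ∀ F : GaugeConfig 4 (2 * S + 1) G → ℝ, Measurable F → (∃ M : ℝ, ∀ U, |F U| ≤ M) →
      IsGaugeInvariant F →
      DependsOn F {e : Edge 4 (2 * S + 1) | ((e.1 0 - s).val = 0 ∨ (e.1 0 - s).val = ℓ - 1) ∧ e.2 ≠ 0} →
      ∃ F₁ : GaugeConfig 4 (2 * S + 1) G → ℝ, Measurable F₁ ∧ (∃ M : ℝ, ∀ U, |F₁ U| ≤ M) ∧
        IsGaugeInvariant F₁ ∧
        (∀ U V : GaugeConfig 4 (2 * S + 1) G,
          (∀ e : Edge 4 (2 * S + 1), ((e.1 0 - s).val = 0 ∨ (e.1 0 - s).val = ℓ - 1) → e.2 ≠ 0 → U e = V e) →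
            F₁ U = F₁ V) ∧
        (∃ K : ℝ, ∀ U V : GaugeConfig 4 (2 * S + 1) G,
          |F₁ U - F₁ V| ≤ K * ∑ e, Real.sqrt (∑ a, ∑ b, ‖(r.ρ (U e) - r.ρ (V e)) a b‖ ^ 2)) ∧
        (∑ e : Edge 4 (2 * S + 1), (if ((e.1 0 - s).val = 0 ∨ (e.1 0 - s).val = ℓ - 1) ∧ e.2 ≠ 0 then
            ∫ U, (Filter.limsup (fun g : G => |F₁ (Function.update U e g) - F₁ U| /
                Real.sqrt (∑ a, ∑ b, ‖(r.ρ g - r.ρ (U e)) a b‖ ^ 2)) (𝓝[≠] (U e))) ^ 2 ∂μ else 0)) / β +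
          ∫ U, (F U - F₁ U) ^ 2 ∂μ ≤
        C * ∫ U, (F U - condExp (cylinderEvents
            {e : Edge 4 (2 * S + 1) | ℓ ≤ (e.1 0 - s).val}) μ F U) ^ 2 ∂μ) →
    ∃ m : ℝ, 0 < m ∧ ∃ S₂ : ℕ, ∀ A B : YMSpecies G, ∃ C' : ℝ, ∀ S n : ℕ, S₂ ≤ S → n ≤ S →
      |latticeConnectedCorr r.ρ β (2 * S + 1) A.F B.F n| ≤ C' * Real.exp (-(m * n)) := by
  intro G _ _ _ _ _ _ r β hβ κ S₀ hP C S₁ hSW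
  set K : ℝ := max (2 * max (κ * β) 1 * C) 1 with hK
  have hK1 : 1 ≤ K := le_max_right _ _
  have hK0 : 0 < K := lt_of_lt_of_le one_pos hK1
  refine stub_gapAt_of_twoTimeRetention G r β (1 / K) (by positivity) ((div_le_one hK0).mpr hK1) (max S₀ S₁) ?_
  intro S hS μ hμ s ℓ h3 hℓ F hFm hFb hFi hFd
  have hS₀ : S₀ ≤ S := le_trans (le_max_left _ _) hS
  have hS₁ : S₁ ≤ S := le_trans (le_max_right _ _) hS
  have hyp : ∀ f : GaugeConfig 4 (2 * S + 1) G → ℝ, IsGaugeInvariant f →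
      (∀ U V : GaugeConfig 4 (2 * S + 1) G,
        (∀ e : Edge 4 (2 * S + 1), ((e.1 0 - s).val = 0 ∨ (e.1 0 - s).val = ℓ - 1) → e.2 ≠ 0 → U e = V e) →
          f U = f V) →
      (∃ K : ℝ, ∀ U V : GaugeConfig 4 (2 * S + 1) G,
        |f U - f V| ≤ K * ∑ e, Real.sqrt (∑ a, ∑ b, ‖(r.ρ (U e) - r.ρ (V e)) a b‖ ^ 2)) →
      ∫ U, (f U - ∫ V, f V ∂μ) ^ 2 ∂μ ≤
        κ * ∑ e : Edge 4 (2 * S + 1), (if ((e.1 0 - s).val = 0 ∨ (e.1 0 - s).val = ℓ - 1) ∧ e.2 ≠ 0 then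
          ∫ U, (Filter.limsup (fun g : G => |f (Function.update U e g) - f U| /
              Real.sqrt (∑ a, ∑ b, ‖(r.ρ g - r.ρ (U e)) a b‖ ^ 2)) (𝓝[≠] (U e))) ^ 2 ∂μ else 0) := by
    subst hμ
    exact hP S hS₀ s ℓ h3 hℓ
  have hret := stub_arcRetention_of_smoothWitnessArc G r β κ C hβ S μ hμ s ℓ hyp
    (hSW S hS₁ μ hμ s ℓ h3 hℓ) F hFm hFb hFi hFd
  have hR : 0 ≤ ∫ U, (F U - condExp (cylinderEvents
      {e : Edge 4 (2 * S + 1) | ℓ ≤ (e.1 0 - s).val}) μ F U) ^ 2 ∂μ :=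
    integral_nonneg fun _ => sq_nonneg _
  have hKK : 2 * max (κ * β) 1 * C ≤ K := le_max_left _ _
  have h2 : ∫ U, (F U - ∫ V, F V ∂μ) ^ 2 ∂μ ≤ K * ∫ U, (F U - condExp (cylinderEvents
      {e : Edge 4 (2 * S + 1) | ℓ ≤ (e.1 0 - s).val}) μ F U) ^ 2 ∂μ :=
    le_trans hret (mul_le_mul_of_nonneg_right hKK hR)
  rw [one_div, inv_mul_le_iff₀ hK0]
  exact h2

end Summit.QuantumFields.YangMills.Theorems.PoincareToGap

end
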